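import Literature.AlgebraicGeometry.HodgeTheory.SupportedClassesAdditivity
import Literature.AlgebraicGeometry.HodgeTheory.RationalLatticeIntegral
import Literature.AlgebraicGeometry.HodgeTheory.ZariskiOpenBettiFiniteness
import Literature.AlgebraicGeometry.Motives.UnramifiedCohomology
import Literature.AlgebraicTopology.SingularHomology.LocallyFlatCriticalDegree
import Literature.AlgebraicTopology.SingularHomology.MayerVietorisFiniteness
import Literature.NumberTheory.Transcendental.AnalytificationConnectedOpen
import HarnessLib

/-!
# `H₁((X ∖ Z)(ℂ); ℤ)` is finitely generated for every Zariski open of a smooth projective complex variety (Dimca 1992, Cor. (6.10), in degree one — proved)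

Family `hodge`, layer `Literature/AlgebraicGeometry/HodgeTheory`. A. Dimca, *Singularities and
Topology of Hypersurfaces* (1992), Ch. 1 Cor. (6.10): a complex algebraic variety has the homotopy
type of a finite CW complex, so its integral homology is finitely generated. The tree records the
homological shadow on the Zariski opens `X ∖ Z` of a smooth projective `X/ℂ` as the NAMED FACT
`Dimca1992_finite_singularHomology_complexPointsCompl` (`HodgeTheory/ZariskiOpenBettiFiniteness`, all
degrees `k`). This file PROVES its degree-one instance, with no stratification theory:

* `finite_singularHomology_complexPointsCompl_of_lt_coheight` — `Hᵢ((X ∖ Z)(ℂ); ℤ)` is finitely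
  generated for `i + 1 < 2 codim Z` (it embeds in `Hᵢ(X(ℂ); ℤ)`, homological semipurity
  `injective_map_complexPointsCompl_of_lt_coheight`, and `X(ℂ)` is a compact manifold,
  `finite_singularHomology_int_complexPoints`).
* `finite_singularHomology_one_complexPointsCompl_of_isIrreducible` — for ONE irreducible closed
  `V ⊊ X`: straighten `V(ℂ)` off a closed `Z₁ ⊆ V` of codimension `≥ 2`
  (`GAGADimension.exists_closed_straightening_off`, Serre GAGA at simple points); in the open
  subspace `Y = (X ∖ Z₁)(ℂ)` the set `S = (V ∖ Z₁)(ℂ)` is closed, connected (Shafarevich VII §2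
  Thm. 7.1, `ComplexPoints.isConnected_setOf_pt_mem_inter_of_isIrreducible`) and locally flat of real
  codimension `≥ 2`, so `H₂(Y, Y ∖ S; ℤ) = ℤ · θ` is cyclic (the topological Thom class,
  `exists_forall_mem_span_localHomologyOfSet_of_locallyFlat`, Voisin I §11.1.2 proof of Lemma 11.13);
  `H₁(Y; ℤ) ↪ H₁(X(ℂ); ℤ)` is finitely generated; the exact sequence of the pair
  `H₂(Y, Y ∖ S) → H₁(Y ∖ S) → H₁(Y)` (Hatcher Thm. 2.16) and `Y ∖ S = (X ∖ V)(ℂ)` conclude.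
* `finite_singularHomology_inter_of_union` — Mayer–Vietoris (Hatcher §2.2 p. 149): for open
  `U₁, U₂`, `Hᵢ(U₁ ∩ U₂)` is finitely generated as soon as `Hᵢ(U₁)`, `Hᵢ(U₂)`, `Hᵢ₊₁(U₁ ∪ U₂)` are.
* `finite_singularHomology_one_complexPointsCompl` — **`H₁((X ∖ Z)(ℂ); ℤ)` is finitely generated
  for every Zariski-closed `Z` of a smooth projective `X/ℂ`**: induction on the irreducible
  components `V` of `Z` (`X` is Noetherian), with `(X ∖ (V ∪ Z'))(ℂ) = (X ∖ V)(ℂ) ∩ (X ∖ Z')(ℂ)`,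
  `(X ∖ V)(ℂ) ∪ (X ∖ Z')(ℂ) = (X ∖ (V ∩ Z'))(ℂ)` and `codim (V ∩ Z') ≥ 2` when `V ⊄ Z'`
  (Hartshorne II Ex. 3.20), whence `H₂((X ∖ (V ∩ Z'))(ℂ); ℤ) ↪ H₂(X(ℂ); ℤ)` is finitely generated.
* `Dimca1992_finite_singularHomology_complexPointsCompl_one` — the degree-`1` instance of the named
  fact, in its printed shape.

Consumer: the route `GenericDivisibility` of the summit `HodgeConjecture`
(`Summits/HodgeConjecture/HodgeConjecture/Theorems/GenericDivisibilityHodgeClassesGenericallyDivisibleFinite`: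
the hypothesis `hfin` of `hodgeClassesGenericallyDivisible_one`, universal coefficients on
`(X ∖ Z)(ℂ)` in degree `2`). Everything is proved; no definitions, no named facts.

## References

* [Dimca1992] A. Dimca, Singularities and Topology of Hypersurfaces, Universitext, Springer 1992,
  Ch. 1 Cor. (6.10).
* [VoisinHodgeI2002] C. Voisin, Hodge Theory and Complex Algebraic Geometry I, CUP 2002, §11.1.1
  Thm. 11.11, §11.1.2 Lemma 11.13.
* [HatcherAT2002] A. Hatcher, Algebraic Topology, CUP 2002, §2.1 Thm. 2.16, §2.2 p. 149, §3.3.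
* [Shafarevich1994] I. R. Shafarevich, Basic Algebraic Geometry 2, Book 3 Ch. VII §2 Thm. 7.1.
* [Hartshorne1977] R. Hartshorne, Algebraic Geometry, II Ex. 3.20, I Prop. 1.5.
* [SerreGAGA1956] J.-P. Serre, GAGA, Ann. Inst. Fourier 6 (1956), §6 Prop. 3 Cor. 3.
-/

noncomputable section

open CategoryTheory Limits AlgebraicGeometry Set TopologicalSpace
open Literature.AlgebraicTopology.SingularHomology

universe u v w

namespace Literature.AlgebraicGeometry.HodgeTheory

section HodgeTheory

/-! ### Algebra: the middle of an exact triple with finitely generated ends -/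

/-- Over a Noetherian ring, the middle object of an exact `X₁ → X₂ → X₃` of modules with finitely
generated ends is finitely generated (`X₂` is an extension of a submodule of `X₃` by a quotient of
`X₁`). [folklore] -/
theorem moduleFinite_X₂_of_exact {R : Type v} [CommRing R] [IsNoetherianRing R]
    {S : ShortComplex (ModuleCat.{w} R)} (hS : S.Exact) [Module.Finite R S.X₁]
    [Module.Finite R S.X₃] : Module.Finite R S.X₂ := by
  refine Module.Finite.of_fg_top (Submodule.fg_of_fg_map_of_fg_inf_ker S.g.hom ?_ ?_)
  · exact IsNoetherian.noetherian _
  · rw [top_inf_eq, ← hS.moduleCat_range_eq_ker, LinearMap.range_eq_map]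
    exact Module.Finite.fg_top.map _

/-- Finite generation passes along a linear equivalence (explicit-hypothesis form of
`Module.Finite.equiv`, usable when the source is only definitionally the expected one). [folklore] -/
theorem moduleFinite_of_linearEquiv {R : Type*} [Semiring R] {P Q : Type*} [AddCommMonoid P]
    [Module R P] [AddCommMonoid Q] [Module R Q] (h : Module.Finite R P) (e : P ≃ₗ[R] Q) :
    Module.Finite R Q := by
  haveI := h
  exact Module.Finite.equiv e

/-! ### Topology: Mayer–Vietoris finiteness for an intersection of two open sets -/

section Topology

variable (R : Type v) [CommRing R] (M : Type v) [AddCommGroup M] [Module R M]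
variable {Y : Type u} [TopologicalSpace Y]

/-- Finite generation of `Hᵢ(-; M)` is invariant under homeomorphism (explicit-hypothesis form of
the tree's `finite_singularHomology_of_homeomorph`; Hatcher 2002, §2.1). [folklore] -/
theorem finite_singularHomology_of_homeomorph' {A B : Type u} [TopologicalSpace A]
    [TopologicalSpace B] (e : A ≃ₜ B) (i : ℕ) (h : Module.Finite R (singularHomology R M A i)) :
    Module.Finite R (singularHomology R M B i) :=
  moduleFinite_of_linearEquiv h (singularHomology.mapIso R M e i).toLinearEquiv

/-- **Finite generation of `Hᵢ(U₁ ∩ U₂)` by Mayer–Vietoris.** For open `U₁, U₂ ⊆ Y` and a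
Noetherian coefficient ring: if `Hᵢ(U₁)`, `Hᵢ(U₂)` and `Hᵢ₊₁(U₁ ∪ U₂)` are finitely generated then so
is `Hᵢ(U₁ ∩ U₂)` — exactness of `Hᵢ₊₁(U₁ ∪ U₂) → Hᵢ(U₁ ∩ U₂) → Hᵢ(U₁) ⊕ Hᵢ(U₂)` in the
Mayer–Vietoris sequence of the open cover of `U₁ ∪ U₂` by the traces of `U₁`, `U₂` (Hatcher 2002,
§2.2 p. 149; the tree's `mayerVietoris.exact₃_holds`), the pieces being identified with `U₁`, `U₂`,
`U₁ ∩ U₂` through `SphereComplement.preimageValHomeomorphOfSubset`. Companion of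
`openUnion.finite_singularHomology` (the union). [cite: HatcherAT2002, §2.2 p. 149] -/
theorem finite_singularHomology_inter_of_union [IsNoetherianRing R] {U₁ U₂ : Set Y}
    (hU₁ : IsOpen U₁) (hU₂ : IsOpen U₂) (i : ℕ)
    (h₁ : Module.Finite R (singularHomology R M U₁ i))
    (h₂ : Module.Finite R (singularHomology R M U₂ i))
    (h : Module.Finite R (singularHomology R M ↥(U₁ ∪ U₂) (i + 1))) :
    Module.Finite R (singularHomology R M ↥(U₁ ∩ U₂) i) := by
  have hAB := SphereComplement.interior_union_interior_eq_univ hU₁ hU₂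
  have hexc := relativeSingularHomology.isIso_map_of_interior_union_interior_holds R M
    (X := ↥(U₁ ∪ U₂))
  have hex := mayerVietoris.exact₃_holds R M (Subtype.val ⁻¹' U₁ : Set ↥(U₁ ∪ U₂))
    (Subtype.val ⁻¹' U₂) hexc hAB i
  -- the two ends are finitely generated
  haveI : Module.Finite R (singularHomology R M ↥(Subtype.val ⁻¹' U₁ : Set ↥(U₁ ∪ U₂)) i) :=
    haveI := h₁
    finite_singularHomology_of_homeomorph
      (SphereComplement.preimageValHomeomorphOfSubset (subset_union_left : U₁ ⊆ U₁ ∪ U₂)).symm i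
  haveI : Module.Finite R (singularHomology R M ↥(Subtype.val ⁻¹' U₂ : Set ↥(U₁ ∪ U₂)) i) :=
    haveI := h₂
    finite_singularHomology_of_homeomorph
      (SphereComplement.preimageValHomeomorphOfSubset (subset_union_right : U₂ ⊆ U₁ ∪ U₂)).symm i
  haveI : Module.Finite R ↑(singularHomology R M ↥(Subtype.val ⁻¹' U₁ : Set ↥(U₁ ∪ U₂)) i ⊞
      singularHomology R M ↥(Subtype.val ⁻¹' U₂ : Set ↥(U₁ ∪ U₂)) i) :=
    Module.Finite.equiv (ModuleCat.biprodIsoProd _ _).symm.toLinearEquiv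
  haveI := h
  have hAB' : Module.Finite R (singularHomology R M
      ↥((Subtype.val ⁻¹' U₁ : Set ↥(U₁ ∪ U₂)) ∩ Subtype.val ⁻¹' U₂) i) :=
    moduleFinite_X₂_of_exact hex
  exact finite_singularHomology_of_homeomorph' R M (SphereComplement.preimageValHomeomorphOfSubset
    (S := U₁ ∪ U₂) (T := U₁ ∩ U₂) (inter_subset_left.trans subset_union_left)) i hAB'

end Topology

/-! ### Zariski opens of a smooth projective complex variety -/

variable {n : ℕ} {X : Motives.SchemeOver ℂ}

/-- The total space of a smooth projective variety is a Noetherian topological space (finite type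
over a field). Local copy of `noetherianSpace_of_isSmoothProjective` (file
`CorrespondenceSupportedVanishing`, not imported to keep the closure small).
[cite: Hartshorne1977, II Prop. 3.2 and II Ex. 2.13] -/
private theorem noetherianSpace_of_isSmoothProjective₁ (hX : Motives.IsSmoothProjective n X) :
    TopologicalSpace.NoetherianSpace ↥X.left := by
  haveI := Motives.IsSmoothProjective.isLocallyNoetherian_holds hX
  haveI := Motives.IsSmoothProjective.compactSpace_holds hX
  haveI : IsNoetherian X.left := {}
  infer_instance

/-- Strict specialisation raises the codimension: `g ⤳ x`, `g ≠ x`, `codim g ≥ l` ⟹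
`codim x ≥ l + 1`. Local copy of `add_one_le_coheight_of_specializes` (file
`AlgebraicClassesCupAbelianVariety`, not imported). [cite: Hartshorne1977, II Ex. 3.20] -/
private theorem add_one_le_coheight_of_specializes₁ {g x : X.left} (h : g ⤳ x) (hne : g ≠ x)
    {l : ℕ} (hl : (l : ℕ∞) ≤ Order.coheight g) : ((l + 1 : ℕ) : ℕ∞) ≤ Order.coheight x := by
  have hlt : x < g := by
    refine lt_of_le_not_ge (Scheme.le_iff_specializes.2 h) fun h' ↦ hne ?_
    exact (h.antisymm (Scheme.le_iff_specializes.1 h')).eq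
  calc ((l + 1 : ℕ) : ℕ∞) = (l : ℕ∞) + 1 := by push_cast; rfl
    _ ≤ Order.coheight g + 1 := add_le_add hl le_rfl
    _ ≤ Order.coheight x := Order.coheight_add_one_le hlt

/-- **`Hᵢ((X ∖ Z)(ℂ); ℤ)` is finitely generated for `i + 1 < 2 codim Z`.** For `X` smooth
projective over `ℂ` and `Z ⊆ X` Zariski-closed with every point of codimension `≥ c`, the map
`Hᵢ((X ∖ Z)(ℂ); ℤ) → Hᵢ(X(ℂ); ℤ)` is one-to-one for `i + 1 < 2c` (Voisin I, Lemma 11.13 along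
Thm. 11.11; the tree's `injective_map_complexPointsCompl_of_lt_coheight`) and `Hᵢ(X(ℂ); ℤ)` is
finitely generated (`X(ℂ)` is a compact manifold, `finite_singularHomology_int_complexPoints`).
[cite: VoisinHodgeI2002, §11.1.2 Lemma 11.13 and §11.1.1 Thm. 11.11]
[cite: HatcherAT2002, App. A Cor. A.9] -/
theorem finite_singularHomology_complexPointsCompl_of_lt_coheight (hX : Motives.IsSmoothProjective n X)
    {Z : Set X.left} (hZ : IsClosed Z) {c : ℕ} (hcZ : ∀ z ∈ Z, (c : ℕ∞) ≤ Order.coheight z) {i : ℕ}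
    (hi : i + 1 < 2 * c) :
    Module.Finite ℤ (singularHomology ℤ ℤ (Motives.complexPointsCompl X Z) i) := by
  haveI := finite_singularHomology_int_complexPoints hX i
  exact Module.Finite.of_injective
    (singularHomology.map ℤ ℤ (subsetIncl {P : Motives.ComplexPoints X | P.pt ∉ Z}) i).hom
    (injective_map_complexPointsCompl_of_lt_coheight ℤ ℤ hX hZ hcZ hi)

/-- **`H₁((X ∖ V)(ℂ); ℤ)` is finitely generated for `V` irreducible.** For `X` smooth projective
over `ℂ` and `V ⊆ X` Zariski-closed, irreducible, with every point of codimension `≥ 1`: straighten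
`V(ℂ)` off a closed `Z₁ ⊆ V` of codimension `≥ 2` (`GAGADimension.exists_closed_straightening_off`);
in `Y = (X ∖ Z₁)(ℂ)` the closed subset `S = (V ∖ Z₁)(ℂ)` is connected
(`ComplexPoints.isConnected_setOf_pt_mem_inter_of_isIrreducible`) and locally flat of real
codimension `≥ 2`, so `H₂(Y, Y ∖ S; ℤ)` is generated by the topological Thom class
(`exists_forall_mem_span_localHomologyOfSet_of_locallyFlat`); `H₁(Y; ℤ)` is finitely generated
(`finite_singularHomology_complexPointsCompl_of_lt_coheight`, `codim Z₁ ≥ 2`); conclude by the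
exact sequence of the pair `H₂(Y, Y ∖ S) → H₁(Y ∖ S) → H₁(Y)` and `Y ∖ S = (X ∖ V)(ℂ)`.
[cite: VoisinHodgeI2002, §11.1.2 proof of Lemma 11.13] [cite: HatcherAT2002, §2.1 Thm. 2.16]
[cite: Shafarevich1994, Book 3 Ch. VII §2 Thm. 7.1] [cite: SerreGAGA1956, §6 Prop. 3 Cor. 3] -/
theorem finite_singularHomology_one_complexPointsCompl_of_isIrreducible
    (hX : Motives.IsSmoothProjective n X) {V : Set X.left} (hV : IsClosed V) (hVi : IsIrreducible V)
    (hcV : ∀ v ∈ V, ((1 : ℕ) : ℕ∞) ≤ Order.coheight v) :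
    Module.Finite ℤ (singularHomology ℤ ℤ (Motives.complexPointsCompl X V) 1) := by
  -- instances on `X(ℂ)`
  haveI := hX.smoothOfRelativeDimension
  haveI : LocallyOfFiniteType X.hom := by
    haveI : Smooth X.hom := SmoothOfRelativeDimension.smooth n _
    infer_instance
  haveI := Motives.IsSmoothProjective.compactSpace_holds hX
  haveI : SecondCountableTopology (Motives.ComplexPoints X) :=
    Motives.ComplexPoints.secondCountableTopology_of_compactSpace_holds X
  -- the bad set `Z₁` and the straightening charts off it
  obtain ⟨Z₁, hZ₁, hZ₁V, hcZ₁, hstr⟩ := GAGADimension.exists_closed_straightening_off hX hV hcV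
  -- if `V ⊆ Z₁`, every point of `V` has codimension `≥ 2`
  by_cases hVZ : V ⊆ Z₁
  · exact finite_singularHomology_complexPointsCompl_of_lt_coheight hX hV
      (fun v hv ↦ hcZ₁ v (hVZ hv)) (i := 1) (by norm_num)
  -- the open subspace `Y = (X ∖ Z₁)(ℂ)` and its closed subset `S = (V ∖ Z₁)(ℂ)`
  have hO : IsOpen {P : Motives.ComplexPoints X | P.pt ∉ Z₁} :=
    Motives.AlgPoints.isOpen_setOf_pt_mem (X := X) (L := ℂ) ⟨Z₁ᶜ, hZ₁.isOpen_compl⟩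
  set S : Set (Motives.complexPointsCompl X Z₁) := {Q | Q.1.pt ∈ V} with hSdef
  have hS : IsClosed S := by
    have h1 : IsClosed {P : Motives.ComplexPoints X | P.pt ∈ V} :=
      ⟨Motives.AlgPoints.isOpen_setOf_pt_mem (X := X) (L := ℂ) ⟨Vᶜ, hV.isOpen_compl⟩⟩
    exact h1.preimage continuous_subtype_val
  -- `S` is connected: it is `(V ∖ Z₁)(ℂ)` read in the subspace `Y`
  have hSc : IsPreconnected S := by
    have hconn := Motives.ComplexPoints.isConnected_setOf_pt_mem_inter_of_isIrreducible X hV hVi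
      ⟨Z₁ᶜ, hZ₁.isOpen_compl⟩ (by
        obtain ⟨z, hzV, hzZ⟩ := not_subset.1 hVZ
        exact ⟨z, hzV, hzZ⟩)
    have himg : (Subtype.val : Motives.complexPointsCompl X Z₁ → Motives.ComplexPoints X) '' S =
        {P : Motives.ComplexPoints X | P.pt ∈ V ∧ P.pt ∈ ((⟨Z₁ᶜ, hZ₁.isOpen_compl⟩ :
          X.left.Opens) : Set X.left)} := by
      ext P
      constructor
      · rintro ⟨Q, hQ, rfl⟩
        exact ⟨hQ, Q.2⟩
      · rintro ⟨hPV, hPZ⟩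
        exact ⟨⟨P, hPZ⟩, hPV, rfl⟩
    have hind : Topology.IsInducing
        (Subtype.val : Motives.complexPointsCompl X Z₁ → Motives.ComplexPoints X) := ⟨rfl⟩
    rw [← hind.isPreconnected_image, himg]
    exact hconn.isPreconnected
  -- local flatness of `S` in `Y`, of real codimension `≥ 2`
  have hflat : ∀ x ∈ S, ∃ (F : Type) (_ : NormedAddCommGroup F) (_ : NormedSpace ℝ F)
      (_ : FiniteDimensional ℝ F) (K : Type) (_ : NormedAddCommGroup K) (_ : NormedSpace ℝ K)
      (e : OpenPartialHomeomorph (Motives.complexPointsCompl X Z₁) (F × K)),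
      2 ≤ Module.finrank ℝ F ∧ x ∈ e.source ∧ ∀ z ∈ e.source, z ∈ S ↔ (e z).1 = 0 := by
    intro x hx
    obtain ⟨c', K, e, hcc', hxe, he⟩ := hstr x.1 hx x.2
    let s : Opens (Motives.ComplexPoints X) := ⟨{P | P.pt ∉ Z₁}, hO⟩
    let e' : OpenPartialHomeomorph (Motives.complexPointsCompl X Z₁) ((Fin c' → ℂ) × ↥K) :=
      e.subtypeRestr (s := s) ⟨x⟩
    have he's : e'.source = Subtype.val ⁻¹' e.source := OpenPartialHomeomorph.subtypeRestr_source e ⟨x⟩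
    have he'a : ∀ z : Motives.complexPointsCompl X Z₁, e' z = e z.1 := fun z ↦ rfl
    refine ⟨Fin c' → ℂ, inferInstance, inferInstance, inferInstance, ↥K, inferInstance,
      inferInstance, e', ?_, ?_, fun z hz ↦ ?_⟩
    · have hfr : Module.finrank ℝ (Fin c' → ℂ) = 2 * c' := by
        rw [Module.finrank_pi_fintype, Finset.sum_const, Finset.card_univ, Fintype.card_fin,
          Complex.finrank_real_complex, smul_eq_mul, mul_comm]
      rw [hfr]
      omega
    · rw [he's]
      exact hxe
    · rw [he's] at hz
      rw [he'a]
      exact he z.1 hz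
  -- the topological Thom class: `H₂(Y | S; ℤ)` is cyclic, hence finitely generated
  haveI : SecondCountableTopology (Motives.complexPointsCompl X Z₁) :=
    inferInstanceAs (SecondCountableTopology ↥{P : Motives.ComplexPoints X | P.pt ∉ Z₁})
  obtain ⟨θ, hθ⟩ := exists_forall_mem_span_localHomologyOfSet_of_locallyFlat ℤ hS hSc (k := 2)
    le_rfl hflat
  haveI : Module.Finite ℤ (localHomologyOfSet ℤ ℤ (Motives.complexPointsCompl X Z₁) S (1 + 1)) :=
    ⟨⟨{θ}, by rw [Finset.coe_singleton]; exact eq_top_iff.2 fun x _ ↦ hθ x⟩⟩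
  -- `H₁(Y; ℤ)` is finitely generated (`codim Z₁ ≥ 2`)
  haveI : Module.Finite ℤ (singularHomology ℤ ℤ (Motives.complexPointsCompl X Z₁) 1) :=
    finite_singularHomology_complexPointsCompl_of_lt_coheight hX hZ₁ hcZ₁ (i := 1) (by norm_num)
  -- the exact sequence of the pair: `H₂(Y | S) → H₁(Y ∖ S) → H₁(Y)`
  haveI : Module.Finite ℤ (singularHomology ℤ ℤ ↥Sᶜ 1) :=
    moduleFinite_X₂_of_exact
      (relativeSingularHomology.exact_δ_map ℤ ℤ (X := Motives.complexPointsCompl X Z₁) Sᶜ 1)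
  -- `Y ∖ S = (X ∖ V)(ℂ)`
  let g : ↥Sᶜ ≃ₜ Motives.complexPointsCompl X V :=
    { toFun := fun Q ↦ ⟨Q.1.1, Q.2⟩
      invFun := fun P ↦ ⟨⟨P.1, fun h ↦ P.2 (hZ₁V h)⟩, P.2⟩
      left_inv := fun _ ↦ rfl
      right_inv := fun _ ↦ rfl
      continuous_toFun := by fun_prop
      continuous_invFun := by fun_prop }
  exact finite_singularHomology_of_homeomorph g 1

/-- **`H₁((X ∖ ⋃ Vⱼ)(ℂ); ℤ)` is finitely generated for finitely many irreducible closed `Vⱼ ⊊ X`**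
(induction on the number of pieces). Step: either `V ⊆ ⋃ Vⱼ` (drop it), or every point of
`V ∩ ⋃ Vⱼ` is a strict specialisation of the generic point of `V`, of codimension `≥ 2`
(Hartshorne II Ex. 3.20), so `H₂((X ∖ (V ∩ ⋃ Vⱼ))(ℂ); ℤ)` is finitely generated
(`finite_singularHomology_complexPointsCompl_of_lt_coheight`) and Mayer–Vietoris for the open cover
`{(X ∖ V)(ℂ), (X ∖ ⋃ Vⱼ)(ℂ)}` of `(X ∖ (V ∩ ⋃ Vⱼ))(ℂ)`, whose intersection is `(X ∖ (V ∪ ⋃ Vⱼ))(ℂ)`,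
applies (`finite_singularHomology_inter_of_union`). [cite: HatcherAT2002, §2.2 p. 149]
[cite: Hartshorne1977, II Ex. 3.20 and I Prop. 1.5] -/
theorem finite_singularHomology_one_complexPointsCompl_sUnion (hX : Motives.IsSmoothProjective n X)
    (T : Finset (Set X.left)) (hTc : ∀ t ∈ T, IsClosed t) (hTi : ∀ t ∈ T, IsIrreducible t)
    (hT1 : ∀ t ∈ T, ∀ z ∈ t, ((1 : ℕ) : ℕ∞) ≤ Order.coheight z) :
    Module.Finite ℤ (singularHomology ℤ ℤ
      (Motives.complexPointsCompl X (⋃₀ (↑T : Set (Set X.left)))) 1) := by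
  classical
  induction T using Finset.induction_on with
  | empty =>
    rw [Finset.coe_empty, Set.sUnion_empty]
    exact finite_singularHomology_complexPointsCompl_of_lt_coheight hX isClosed_empty (c := 2)
      (fun z hz ↦ (Set.notMem_empty z hz).elim) (i := 1) (by norm_num)
  | insert V T hVT ih =>
    have hVc : IsClosed V := hTc V (Finset.mem_insert_self V T)
    have hVi : IsIrreducible V := hTi V (Finset.mem_insert_self V T)
    have hV1 : ∀ z ∈ V, ((1 : ℕ) : ℕ∞) ≤ Order.coheight z := hT1 V (Finset.mem_insert_self V T)
    have ih' := ih (fun t ht ↦ hTc t (Finset.mem_insert_of_mem ht))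
      (fun t ht ↦ hTi t (Finset.mem_insert_of_mem ht)) (fun t ht ↦ hT1 t (Finset.mem_insert_of_mem ht))
    have hU : IsClosed (⋃₀ (↑T : Set (Set X.left))) := by
      rw [Set.sUnion_eq_biUnion]
      exact T.finite_toSet.isClosed_biUnion fun t ht ↦ hTc t (Finset.mem_insert_of_mem ht)
    rw [Finset.coe_insert, Set.sUnion_insert]
    by_cases hsub : V ⊆ ⋃₀ (↑T : Set (Set X.left))
    · rw [Set.union_eq_self_of_subset_left hsub]
      exact ih'
    -- `codim (V ∩ ⋃ T) ≥ 2`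
    have hint : ∀ t ∈ V ∩ ⋃₀ (↑T : Set (Set X.left)), ((1 + 1 : ℕ) : ℕ∞) ≤ Order.coheight t := by
      rintro x ⟨hxV, hxU⟩
      obtain ⟨t, ht, hxt⟩ := Set.mem_sUnion.1 hxU
      have hη := hVi.isGenericPoint_genericPoint hVc
      refine add_one_le_coheight_of_specializes₁ (hη.specializes hxV) (fun heq ↦ hsub ?_)
        (hV1 _ hη.mem)
      have hηt : hVi.genericPoint ∈ t := by rw [heq]; exact hxt
      exact ((hη.mem_closed_set_iff (hTc t (Finset.mem_insert_of_mem ht))).1 hηt).trans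
        (Set.subset_sUnion_of_mem ht)
    -- the open cover `{(X ∖ V)(ℂ), (X ∖ ⋃ T)(ℂ)}` of `(X ∖ (V ∩ ⋃ T))(ℂ)`
    have hO₁ : IsOpen {P : Motives.ComplexPoints X | P.pt ∉ V} :=
      Motives.AlgPoints.isOpen_setOf_pt_mem (X := X) (L := ℂ) ⟨Vᶜ, hVc.isOpen_compl⟩
    have hO₂ : IsOpen {P : Motives.ComplexPoints X | P.pt ∉ ⋃₀ (↑T : Set (Set X.left))} :=
      Motives.AlgPoints.isOpen_setOf_pt_mem (X := X) (L := ℂ) ⟨(⋃₀ (↑T : Set (Set X.left)))ᶜ,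
        hU.isOpen_compl⟩
    -- `H₂` of the union `(X ∖ (V ∩ ⋃ T))(ℂ)` is finitely generated
    have hf2 : Module.Finite ℤ (singularHomology ℤ ℤ
        (Motives.complexPointsCompl X (V ∩ ⋃₀ (↑T : Set (Set X.left)))) 2) :=
      finite_singularHomology_complexPointsCompl_of_lt_coheight hX (hVc.inter hU) hint (i := 2)
        (by norm_num)
    let e₂ : Motives.complexPointsCompl X (V ∩ ⋃₀ (↑T : Set (Set X.left))) ≃ₜ
        ↥({P : Motives.ComplexPoints X | P.pt ∉ V} ∪
          {P : Motives.ComplexPoints X | P.pt ∉ ⋃₀ (↑T : Set (Set X.left))}) :=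
      { toFun := fun P ↦ ⟨P.1, by
          rcases not_and_or.1 P.2 with h | h
          · exact Or.inl h
          · exact Or.inr h⟩
        invFun := fun Q ↦ ⟨Q.1, fun h ↦ by
          rcases Q.2 with h' | h'
          · exact h' h.1
          · exact h' h.2⟩
        left_inv := fun _ ↦ rfl
        right_inv := fun _ ↦ rfl
        continuous_toFun := by fun_prop
        continuous_invFun := by fun_prop }
    have hf2' : Module.Finite ℤ (singularHomology ℤ ℤ
        ↥({P : Motives.ComplexPoints X | P.pt ∉ V} ∪
          {P : Motives.ComplexPoints X | P.pt ∉ ⋃₀ (↑T : Set (Set X.left))}) (1 + 1)) :=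
      moduleFinite_of_linearEquiv hf2 (singularHomology.mapIso ℤ ℤ e₂ 2).toLinearEquiv
    -- `H₁` of the two open pieces is finitely generated
    have hf₁ : Module.Finite ℤ (singularHomology ℤ ℤ ↥{P : Motives.ComplexPoints X | P.pt ∉ V} 1) :=
      finite_singularHomology_one_complexPointsCompl_of_isIrreducible hX hVc hVi hV1
    have hf₂ : Module.Finite ℤ (singularHomology ℤ ℤ
        ↥{P : Motives.ComplexPoints X | P.pt ∉ ⋃₀ (↑T : Set (Set X.left))} 1) := ih'
    -- Mayer–Vietoris: `H₁` of the intersection `(X ∖ (V ∪ ⋃ T))(ℂ)` is finitely generated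
    have key := finite_singularHomology_inter_of_union ℤ ℤ hO₁ hO₂ 1 hf₁ hf₂ hf2'
    let e₁ : ↥({P : Motives.ComplexPoints X | P.pt ∉ V} ∩
          {P : Motives.ComplexPoints X | P.pt ∉ ⋃₀ (↑T : Set (Set X.left))}) ≃ₜ
        Motives.complexPointsCompl X (V ∪ ⋃₀ (↑T : Set (Set X.left))) :=
      { toFun := fun Q ↦ ⟨Q.1, fun h ↦ by
          rcases h with h' | h'
          · exact Q.2.1 h'
          · exact Q.2.2 h'⟩
        invFun := fun P ↦ ⟨P.1, ⟨fun h ↦ P.2 (Or.inl h), fun h ↦ P.2 (Or.inr h)⟩⟩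
        left_inv := fun _ ↦ rfl
        right_inv := fun _ ↦ rfl
        continuous_toFun := by fun_prop
        continuous_invFun := by fun_prop }
    exact moduleFinite_of_linearEquiv key (singularHomology.mapIso ℤ ℤ e₁ 1).toLinearEquiv

/-- **`H₁((X ∖ Z)(ℂ); ℤ)` is finitely generated** for `X` smooth projective over `ℂ` and every
Zariski-closed `Z ⊆ X` (Dimca 1992, Ch. 1 Cor. (6.10), in degree one; here from the straightening of
the irreducible components of `Z` off codimension `2`, the topological Thom class in the critical
degree, homological semipurity and Mayer–Vietoris — no Whitney stratification). For `Z = X` the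
space is empty. [cite: Dimca1992, Ch. 1 Cor. (6.10)] [cite: VoisinHodgeI2002, §11.1.2 Lemma 11.13]
[cite: HatcherAT2002, §2.2 p. 149 and §2.1 Thm. 2.16] -/
theorem finite_singularHomology_one_complexPointsCompl (hX : Motives.IsSmoothProjective n X)
    {Z : Set X.left} (hZ : IsClosed Z) :
    Module.Finite ℤ (singularHomology ℤ ℤ (Motives.complexPointsCompl X Z) 1) := by
  by_cases hZu : Z = Set.univ
  · subst hZu
    haveI : IsEmpty (Motives.complexPointsCompl X Set.univ) := ⟨fun P ↦ P.2 (Set.mem_univ _)⟩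
    haveI := relativeSingularHomology.isIso_ofAbsolute_of_isEmpty ℤ ℤ
      (X := Motives.complexPointsCompl X Set.univ) Set.univ 1
    have h0 : IsZero (singularHomology ℤ ℤ (Motives.complexPointsCompl X Set.univ) 1) :=
      (isZero_relativeSingularHomology_univ ℤ ℤ
        (X := Motives.complexPointsCompl X Set.univ) 1).of_iso
        (asIso (relativeSingularHomology.ofAbsolute ℤ ℤ (Motives.complexPointsCompl X Set.univ)
          Set.univ 1))
    haveI := ModuleCat.subsingleton_of_isZero h0
    exact Module.Finite.of_finite
  haveI := noetherianSpace_of_isSmoothProjective₁ hX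
  haveI : IsIntegral X.left := Motives.IsSmoothProjective.isIntegral_holds hX
  have h1 : ∀ z ∈ Z, ((1 : ℕ) : ℕ∞) ≤ Order.coheight z :=
    (Motives.forall_one_le_coheight_iff_ne_univ hZ).2 hZu
  obtain ⟨T, hTf, hTc, hTi, hZT⟩ := NoetherianSpace.exists_finite_set_isClosed_irreducible hZ
  lift T to Finset (Set X.left) using hTf
  have hT1 : ∀ t ∈ T, ∀ z ∈ t, ((1 : ℕ) : ℕ∞) ≤ Order.coheight z := fun t ht z hz ↦
    h1 z (by rw [hZT]; exact Set.mem_sUnion_of_mem hz (Finset.mem_coe.2 ht))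
  subst hZT
  exact finite_singularHomology_one_complexPointsCompl_sUnion hX T
    (fun t ht ↦ hTc t (Finset.mem_coe.2 ht)) (fun t ht ↦ hTi t (Finset.mem_coe.2 ht)) hT1

/-- **Dimca 1992, Cor. (6.10), in degree one — discharged**: the `k = 1` instance of the named fact
`Dimca1992_finite_singularHomology_complexPointsCompl` (`HodgeTheory/ZariskiOpenBettiFiniteness`), in
its printed shape. [cite: Dimca1992, Ch. 1 Cor. (6.10)] -/
theorem Dimca1992_finite_singularHomology_complexPointsCompl_one :
    ∀ ⦃n : ℕ⦄ ⦃X : Motives.SchemeOver ℂ⦄, Motives.IsSmoothProjective n X →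
      ∀ (Z : Set X.left), IsClosed Z →
        Module.Finite ℤ (singularHomology ℤ ℤ (Motives.complexPointsCompl X Z) 1) :=
  fun _ _ hX _ hZ ↦ finite_singularHomology_one_complexPointsCompl hX hZ

end HodgeTheory

end Literature.AlgebraicGeometry.HodgeTheory

end
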